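import Summits.QuantumFields.YangMills.Theorems.BalabanUVNodesN12FlatStraightOntoGenSet
import Summits.QuantumFields.YangMills.Theorems.BalabanUVNodesN12FlatHndConnLetter
import Literature.MathematicalPhysics.QuantumFieldTheory.Balaban1983to89.B15Prop1DatumSmall7AtZSequence
import HarnessLib

/-!
# BalabanUVNodes ∕ N12 — (J-b) module H2a: THE PIN GEOMETRY OF THE READING-(b) ROWS — the fine centre of an INNER end-point of a row determines its level (so a gauge function
# can be pinned there), and THE COLLAR of the record's maximal sequence: a block adjacent to `Ω_{i+1}(Z)^{(i+1)}` lies pointwise in `Ω_i(Z)` (`M₁ ≥ 2`, r11's `dist_maxDomT`)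

Cell `pub-ymgap` (HUMAN RULINGS D-0062 ∕ D-0149), width seat `pub-ymgap-dag-n10-w1` g3; modules H1a∕H1b = `…N12FlatStraightOntoRows` (p615796) ∕ `…N12FlatStraightOntoGenSet`
(p616977).  Key K1⁷ `stmt-QuantumFields-20542`, `--kind proof --supports … --as helper`; count-neutral; THEOREMS ONLY (0 `def`, 0 `sorry`, 0 `instance`, 0 `notation`).
WHY.  Module H2b turns the straight right inverse of H1b into a right inverse of NODE 00's TRUE linearised multi-scale averaging `qLin j 1 = L^j·Q_j − dΛ_j` (UST
`ChartHInv.linFamily_eq_sub_comb`) by a gauge function `φ` PINNED at the fine centres `embIter j w` of the INNER end-points `w` of the rows (centre in `Ω_j`; under reading (b)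
these include the DEEP end-points of the `Γ_j → Ω_{j+1}` crossing bonds) and by UST's κ-correction at the OUTER end-points.  Two geometric facts are needed and proved here:
(§3) the pin map `(j, w) ↦ embIter j w` is injective across levels — a deep end-point adjacent to `Γ_j` is never the central sub-block of its parent, because the centre's
lattice neighbours stay in the parent block (`L ≥ 3`, §1); (§4) the collar «every `i`-sub-block of an `(i+1)`-block adjacent to `Ω_{i+1}^{(i+1)}` has its centre in `Ω_i`»,
which H2b DISPLAYS for a general family, HOLDS for r11's maximal sequence `maxDomT M₁ Z` with `M₁ ≥ 2` (print's *«dist(Ω_n, Ωᶜ_{n−1}) ≧ LⁿξM₁»*).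

CONSUMED BY NAME, nothing modified: H1b (`mem_iff_embIter_iterBlockOf_mem`, `embIter_mem_of_mem_genSet`, `embIter_not_mem_succ_of_mem_genSet`, `subset_of_nested`), n12-w3's
`N12FlatHndConnLetter.embIter_iterBlockOf_embIter`, r11's `B14.Eq213DetSet` (`maxDomT`, `dist_maxDomT`, `val_embIter_div`), r12's `B15Eq112TorusCover` (`cover`, `lift`, `cover_lift`)
and `B15Prop1DatumSmall7AtZSequence.cover_add_single_pow` (a `T^{(j)}`-step on the cover), `B14DomainGeom.Within`, p27's `BIJ85CurlQsstar.blockOf_shift_blockSite`∕`shift_blockSite_of_lt`,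
`B10StarCount.shift_unshift`∕`unshift_shift`, p39's `iterBlockOf`∕`val_iterBlockOf`, `BIJ88RT51Background.iterBlockOf_embIter`.

CONTENTS.  §1 `emb_eq_blockSite`, ★ `blockOf_shift_emb`, ★ `blockOf_unshift_emb` (`blockOf (emb W ± e_μ) = W`).  §2 `embIter_mem_iff_of_isBlockUnion_succ` (a union of `(i+1)`-blocks
read at level `i`).  §3 ★★ `false_of_embIter_eq_of_endpoint` — PIN UNIQUENESS: for nested block-measurable `Ω`, if the centre of an end-point `w` of a level-`j` row equals the centre of
a `j′`-site `w′` with centre in `Ω_{j′}`, `j < j′ ≤ k`, then `False`.  §4 `abs_sub_le_of_div_eq`, ★★ `mem_maxDomT_of_adjacent` (every FINE point of a `T^{(i+1)}`-block adjacent to a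
block with centre in `Ω_{i+1}(Z)` lies in `Ω_i(Z)`; `2 ≤ M₁`, `i + 1 ≤ J`, `L^J·M₁ ∣ sitesPerDir 0`, `i + 1 ≤ m + K`), ★ `embIter_mem_maxDomT_of_adjacent` (sub-block form = H2b's
`hcollar` at the record).

HONEST FRAMING.  Pure lattice geometry (finite set algebra on the tree's tori and r11's cover); nothing of Bałaban's analysis asserted; N12 ∕ N10 ∕ N07 NOT discharged; K1⁷ NOT
closed; count-neutral (typed 28∕28 · discharged 5∕27 unmoved); one finite 𝕋⁴ programme at fixed ε — R4 closes the conditional rung `BalabanLadder.UV` only; the YM mass gap (Clay)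
is NOT proved by any of this; nothing continuum ∕ ℝ⁴ ∕ OS.
-/

noncomputable section

open scoped BigOperators

namespace Summit.QuantumFields.YangMills.BalabanUVNodes.N12FlatLinAvgOntoPins

open Literature.MathematicalPhysics.QuantumFieldTheory.Balaban1983to89
open LatticeFieldCalculus B5Eq118OneStroke B15DeterminingSets
open B14.Eq22Determines (IsBlockUnion)
open B14.Eq213DetSet (Bj maxDomT maxDomT_succ_subset isBlockUnion_maxDomT dist_maxDomT val_embIter_div)
open B14.Eq213MaximalDomains (side)
open B14DomainGeom (Pt Within)
open B15Eq112TorusCover (cover lift cover_lift cover_apply)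
open B10StarCount (shift_unshift unshift_shift)
open Literature.MathematicalPhysics.QuantumFieldTheory.BalabanImbrieJaffe1984to88.BIJ85CurlQsstar (blockOf_shift_blockSite shift_blockSite_of_lt)
open Literature.MathematicalPhysics.QuantumFieldTheory.BalabanImbrieJaffe1984to88.BIJ88RT51Background (iterBlockOf_embIter)
open B15Prop1DatumSmall7AtZSequence (cover_add_single_pow)
open N12FlatHndConnLetter (embIter_iterBlockOf_embIter)
open N12FlatStraightOntoGenSet (mem_iff_embIter_iterBlockOf_mem embIter_mem_of_mem_genSet embIter_not_mem_succ_of_mem_genSet subset_of_nested)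

variable {P : Params}

/-! ## §1  The centre of a block and its lattice neighbours lie in the block (`L ≥ 3`, odd) -/

section Centre

variable {i : ℕ}

/-- The centre `emb W` is the block site of `W` with all offsets `(L − 1)/2`. [cite: Balaban1987RG1, (0.1) p.251] -/
theorem emb_eq_blockSite (W : Site P (i + 1)) :
    emb W = Site.blockSite W (fun _ => ⟨(P.L - 1) / 2, by have := P.hL.2; omega⟩) := rfl

/-- `B(W)` contains the forward neighbour of its centre: `blockOf (emb W + e_μ) = W`. [cite: Balaban1987RG1, (0.1) p.251] -/
theorem blockOf_shift_emb (hi : i + 1 ≤ P.m + P.K) (W : Site P (i + 1)) (μ : Fin P.d) : blockOf ((emb W).shift μ) = W := by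
  have hL3 : 3 ≤ P.L := by have := P.hL.2; obtain ⟨t, ht⟩ := P.hL.1; omega
  rw [emb_eq_blockSite, blockOf_shift_blockSite hi, if_neg]
  simp only; omega

/-- `B(W)` contains the backward neighbour of its centre: `blockOf (emb W − e_μ) = W`. [cite: Balaban1987RG1, (0.1) p.251] -/
theorem blockOf_unshift_emb (hi : i + 1 ≤ P.m + P.K) (W : Site P (i + 1)) (μ : Fin P.d) : blockOf ((emb W).unshift μ) = W := by
  have hL3 : 3 ≤ P.L := by have := P.hL.2; obtain ⟨t, ht⟩ := P.hL.1; omega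
  let r : Fin P.d → Fin P.L := Function.update (fun _ => ⟨(P.L - 1) / 2, by omega⟩) μ ⟨(P.L - 1) / 2 - 1, by omega⟩
  have hr : (r μ : ℕ) + 1 < P.L := by simp only [r, Function.update_self]; omega
  have hz : (Site.blockSite W r).shift μ = emb W := by
    rw [shift_blockSite_of_lt W r μ hr, emb_eq_blockSite]
    congr 1
    funext ν
    by_cases hν : ν = μ
    · subst hν; simp only [Function.update_self, r]; apply Fin.ext; simp only; omega
    · simp only [r, Function.update_of_ne hν]
  rw [← hz, unshift_shift, Site.blockOf_blockSite hi]

end Centre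

/-! ## §2  Reading a union of `(i+1)`-blocks at level `i` -/

/-- For a union `X` of `(i+1)`-blocks and an `i`-site `v`: the centre of `v` lies in `X` iff the centre of the block of `v` does.
[cite: Balaban1988Convergent, (2.1)-(2.2) p.255] -/
theorem embIter_mem_iff_of_isBlockUnion_succ {X : Set (Site P 0)} {i : ℕ} (hX : IsBlockUnion (i + 1) X) (hi : i + 1 ≤ P.m + P.K) (v : Site P i) :
    embIter i v ∈ X ↔ embIter (i + 1) (blockOf v) ∈ X := by
  rw [mem_iff_embIter_iterBlockOf_mem hX le_rfl hi (embIter i v), iterBlockOf_succ, iterBlockOf_embIter i (by omega) v]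

/-! ## §3  PINS: the fine centre of an inner end-point of a reading-(b) row determines its level -/

section Pins

variable (Ω : ℕ → Set (Site P 0)) {k : ℕ}

/-- ★★ **PIN UNIQUENESS ACROSS LEVELS.**  Let `Ω₁ ⊇ ⋯ ⊇ Ω_k` be nested with `Ω_i` a union of `i`-blocks.  If the centre of a `j`-site `w` that is an end-point of a level-`j` row
(a `j`-bond meeting `Γ_j`) coincides with the centre of a `j'`-site `w'` INSIDE `Ω_{j'}` with `j < j' ≤ k`, contradiction: `w` would be the central sub-block of a
`(j+1)`-block `W` with centre in `Ω_{j+1}`, and `w` together with its lattice neighbours lies in `W` (`L ≥ 3`), so every end-point of the row has its centre in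
`Ω_{j+1}` — but one of them lies in `Γ_j`, off `Ω_{j+1}`. [cite: Balaban1988Convergent, (2.1)-(2.2) p.255, (2.10) p.256; Balaban1987RG1, (0.1) p.251] -/
theorem false_of_embIter_eq_of_endpoint (hkK : k ≤ P.m + P.K) (hnest : ∀ i, 1 ≤ i → i < k → Ω (i + 1) ⊆ Ω i)
    (hmeas : ∀ i, 1 ≤ i → i ≤ k → IsBlockUnion i (Ω i)) {j j' : ℕ} (hjj' : j < j') (hj'k : j' ≤ k) {w : Site P j} {w' : Site P j'}
    (heq : embIter j w = embIter j' w') (hw' : embIter j' w' ∈ Ω j')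
    (hw : ∃ μ : Fin P.d, (⟨w, μ⟩ : PBond P j) ∈ bondsOf (genSet Ω k j) ∨ (⟨w.unshift μ, μ⟩ : PBond P j) ∈ bondsOf (genSet Ω k j)) : False := by
  have hj1 : j + 1 ≤ P.m + P.K := by omega
  -- the `(j+1)`-block `W` over the common centre
  have hxΩ : embIter j' w' ∈ Ω (j + 1) := subset_of_nested Ω hnest (by omega) (by omega : j + 1 ≤ j') hj'k hw'
  have hxW : embIter (j + 1) (iterBlockOf (j + 1) (embIter j' w')) = embIter j' w' := embIter_iterBlockOf_embIter hj1 (by omega) w'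
  have hwW : w = emb (iterBlockOf (j + 1) (embIter j' w')) := by
    have h1 : iterBlockOf j (embIter j' w') = w := by rw [← heq, iterBlockOf_embIter j (by omega)]
    have h2 : iterBlockOf j (embIter (j + 1) (iterBlockOf (j + 1) (embIter j' w'))) = emb (iterBlockOf (j + 1) (embIter j' w')) := by
      rw [show ∀ V : Site P (j + 1), embIter (j + 1) V = embIter j (emb V) from fun _ => rfl, iterBlockOf_embIter j (by omega)]
    rw [hxW] at h2
    rw [← h1, h2]
  generalize hW : iterBlockOf (j + 1) (embIter j' w') = W at hxW hwW
  -- every `j`-site of `W` has its centre in `Ω_{j+1}`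
  have hin : ∀ v : Site P j, blockOf v = W → embIter j v ∈ Ω (j + 1) := fun v hv => by
    rw [embIter_mem_iff_of_isBlockUnion_succ (hmeas (j + 1) (by omega) (by omega)) hj1, hv, hxW]; exact hxΩ
  have hout : ∀ v : Site P j, v ∈ genSet Ω k j → blockOf v = W → False := fun v hv hvW =>
    embIter_not_mem_succ_of_mem_genSet Ω (by omega) hv (hin v hvW)
  obtain ⟨μ, hμ⟩ := hw
  rcases hμ with (h | h) | (h | h)
  · exact hout _ h (by rw [hwW, Site.blockOf_emb hj1])
  · exact hout _ h (by show blockOf (w.shift μ) = W; rw [hwW, blockOf_shift_emb hj1])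
  · exact hout _ h (by rw [hwW, blockOf_unshift_emb hj1])
  · exact hout _ h (by show blockOf ((w.unshift μ).shift μ) = W; rw [shift_unshift, hwW, Site.blockOf_emb hj1])

end Pins

/-! ## §4  THE COLLAR of the record's maximal sequence: a block adjacent to `Ω_{i+1}^{(i+1)}` lies (pointwise) in `Ω_i` (`M₁ ≥ 2`) -/

section Collar

/-- Two naturals with the same quotient by `D` differ by less than `D`. [folklore] -/
theorem abs_sub_le_of_div_eq {a b D : ℕ} (hD : 0 < D) (h : a / D = b / D) : |(a : ℤ) - b| ≤ (D : ℤ) - 1 := by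
  have ha := Nat.div_add_mod a D
  have hb := Nat.div_add_mod b D
  have hma := Nat.mod_lt a hD
  have hmb := Nat.mod_lt b hD
  rw [h] at ha
  generalize b / D = Q at ha hb
  generalize a % D = ra at ha hma
  generalize b % D = rb at hb hmb
  rw [abs_le]
  constructor <;> omega

/-- ★★ **THE COLLAR** (*«dist(Ω_n, Ωᶜ_{n−1}) ≧ LⁿξM₁»*, r11's `dist_maxDomT` on the universal cover): for `M₁ ≥ 2` and the torus divisibility `L^J·M₁ ∣ sitesPerDir 0`, if a
`T^{(i+1)}`-block `W` (`i + 1 ≤ J`, `i + 1 ≤ m + K`) is a lattice neighbour of a block whose centre lies in `Ω_{i+1}(Z)`, then EVERY fine point of `B^{i+1}(W)` lies in `Ω_i(Z)`: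
on the cover the two centres are `L^{i+1}` apart (`cover_add_single_pow`) and a fine point of the block is within `L^{i+1} − 1` of its centre, total `≤ 2L^{i+1} − 1 ≤ L^{i+1}M₁ − 1`.
[cite: Balaban1988Convergent, (2.13) pp.256-257] -/
theorem mem_maxDomT_of_adjacent {M₁ : ℕ} (hM2 : 2 ≤ M₁) {Z : Set (Site P 0)} {J : ℕ} (hdiv : side P.L M₁ J ∣ P.sitesPerDir 0) {i : ℕ}
    (hiJ : i + 1 ≤ J) (hiK : i + 1 ≤ P.m + P.K) (W : Site P (i + 1)) (μ : Fin P.d)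
    (hadj : embIter (i + 1) (W.shift μ) ∈ maxDomT M₁ Z (i + 1) ∨ embIter (i + 1) (W.unshift μ) ∈ maxDomT M₁ Z (i + 1))
    (q : Site P 0) (hq : iterBlockOf (i + 1) q = W) : q ∈ maxDomT M₁ Z i := by
  have hM : 1 ≤ M₁ := by omega
  have hLi : (0 : ℕ) < P.L ^ (i + 1) := pow_pos P.L_pos _
  -- cover points for the centre of the inside neighbour (`xy`) and of `W` (`xw`), `L^{i+1}` apart
  obtain ⟨xy, xw, hxy, hxw, hnear⟩ : ∃ xy xw : Pt P.d, cover P xy ∈ maxDomT M₁ Z (i + 1) ∧ cover P xw = embIter (i + 1) W ∧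
      Within ((P.L ^ (i + 1) : ℕ) : ℤ) xy xw := by
    rcases hadj with h | h
    · refine ⟨lift P (embIter (i + 1) W) + Pi.single μ ((P.L ^ (i + 1) : ℕ) : ℤ), lift P (embIter (i + 1) W), ?_, cover_lift _, fun ν => ?_⟩
      · rw [cover_add_single_pow (i + 1) (cover_lift _) μ]; exact h
      · simp only [Pi.add_apply, add_sub_cancel_left]
        by_cases hν : ν = μ
        · subst hν; rw [Pi.single_eq_same, abs_of_nonneg (by positivity)]
        · rw [Pi.single_eq_of_ne hν, abs_zero]; positivity
    · refine ⟨lift P (embIter (i + 1) (W.unshift μ)), lift P (embIter (i + 1) (W.unshift μ)) + Pi.single μ ((P.L ^ (i + 1) : ℕ) : ℤ), ?_, ?_, fun ν => ?_⟩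
      · rw [cover_lift]; exact h
      · rw [cover_add_single_pow (i + 1) (cover_lift _) μ, shift_unshift]
      · simp only [Pi.add_apply, sub_add_cancel_left, abs_neg]
        by_cases hν : ν = μ
        · subst hν; rw [Pi.single_eq_same, abs_of_nonneg (by positivity)]
        · rw [Pi.single_eq_of_ne hν, abs_zero]; positivity
  -- the fine point `q` on the cover, near the centre of `W`
  let z : Pt P.d := fun ν => xw ν + (((q ν).val : ℤ) - ((embIter (i + 1) W ν).val : ℤ))
  have hz : cover P z = q := by
    funext ν
    have h1 : ((xw ν : ℤ) : ZMod (P.sitesPerDir 0)) = embIter (i + 1) W ν := by rw [← cover_apply, hxw]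
    simp only [z, cover_apply, Int.cast_add, Int.cast_sub, Int.cast_natCast, ZMod.natCast_zmod_val, h1, add_sub_cancel]
  have hδ : ∀ ν, |((q ν).val : ℤ) - ((embIter (i + 1) W ν).val : ℤ)| ≤ ((P.L ^ (i + 1) : ℕ) : ℤ) - 1 := fun ν => by
    apply abs_sub_le_of_div_eq hLi
    rw [← val_iterBlockOf (i + 1) hiK q ν, hq, val_embIter_div hiK]
  have hwithin : Within ((side P.L M₁ (i + 1) : ℤ) - 1) xy z := fun ν => by
    have h1 := hnear ν
    have h2 := hδ ν
    have h3 : |xy ν - z ν| ≤ |xy ν - xw ν| + |((q ν).val : ℤ) - ((embIter (i + 1) W ν).val : ℤ)| := by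
      have : xy ν - z ν = (xy ν - xw ν) - (((q ν).val : ℤ) - ((embIter (i + 1) W ν).val : ℤ)) := by simp only [z]; ring
      rw [this]; exact abs_sub _ _
    have h4 : (2 : ℤ) * (P.L ^ (i + 1) : ℕ) ≤ (side P.L M₁ (i + 1) : ℤ) := by
      unfold side; push_cast; nlinarith [show (2 : ℤ) ≤ M₁ by exact_mod_cast hM2, show (0 : ℤ) ≤ (P.L : ℤ) ^ (i + 1) by positivity]
    linarith
  have := dist_maxDomT hM hdiv hiJ hxy hwithin
  rwa [hz] at this

/-- ★ **THE COLLAR IN SUB-BLOCK FORM** (the hypothesis `hcollar` of module H2b, discharged at the record): every `i`-sub-block `v` of a block `W` of `T^{(i+1)}` adjacent to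
`Ω_{i+1}(Z)^{(i+1)}` has its centre in `Ω_i(Z)` (`M₁ ≥ 2`, `i + 1 ≤ J`, `L^J·M₁ ∣ sitesPerDir 0`). [cite: Balaban1988Convergent, (2.13) pp.256-257] -/
theorem embIter_mem_maxDomT_of_adjacent {M₁ : ℕ} (hM2 : 2 ≤ M₁) {Z : Set (Site P 0)} {J : ℕ} (hdiv : side P.L M₁ J ∣ P.sitesPerDir 0) {i : ℕ}
    (hiJ : i + 1 ≤ J) (hiK : i + 1 ≤ P.m + P.K) (W : Site P (i + 1)) (μ : Fin P.d)
    (hadj : embIter (i + 1) (W.shift μ) ∈ maxDomT M₁ Z (i + 1) ∨ embIter (i + 1) (W.unshift μ) ∈ maxDomT M₁ Z (i + 1))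
    (v : Site P i) (hv : blockOf v = W) : embIter i v ∈ maxDomT M₁ Z i :=
  mem_maxDomT_of_adjacent hM2 hdiv hiJ hiK W μ hadj (embIter i v) (by rw [iterBlockOf_succ, iterBlockOf_embIter i (by omega), hv])

end Collar

end Summit.QuantumFields.YangMills.BalabanUVNodes.N12FlatLinAvgOntoPins

end
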